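import Literature.AlgebraicGeometry.Resolution.EmbeddedResolutionExcellentSurfacesOfHistory
import Literature.AlgebraicGeometry.Resolution.EmbeddedResolutionExcellentSurfacesBoundary
import Summits.ResolutionOfSingularities.ResolutionOfSingularities.Theorems.FrobeniusClosingPatchingRelPerfectDepthLegalRestartBoundary
import Summits.ResolutionOfSingularities.ResolutionOfSingularities.Theorems.RadicialJungCleanModelsStubCossartPiltant2019OfNamedPushDown
import Summits.ResolutionOfSingularities.ResolutionOfSingularities.Theorems.RadicialJungCleanModelsStubCossartPiltant2019OfPrintedDescent
import HarnessLib

/-!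
# Stub 1 of `CleanModels` (F-32, CJS 2020 Thm. 1.4) FROM the construction fact F-72 — and the general-boundary sequence form

OURS (decomp-res hand-1 g21; crux `stmt-ResolutionOfSingularities-15917`, registered skeleton `Cruxes/CleanModels/Lines/Sketch.lean`
rev 35, stub `stub_cjs2020Thm14 : CossartJannsenSaito2020Embedded.{0}`).  The TYPE of stub 1 is a printed theorem carried as a named
fact (F-32).  The tree ALSO carries, as the named CONSTRUCTION fact F-72 `CossartJannsenSaito2020_canonicalSequence_history`
(`EmbeddedResolutionExcellentSurfacesHistory.lean`; consumed by the res-hironaka / FrobeniusClosing files), the book's actual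
process (Cor. 6.26: iterate `Σ^{O,max}`-eliminations with the boundary history) together with Thm. 6.9 (a)'s end clauses.  The
Literature file `EmbeddedResolutionExcellentSurfacesOfHistory.lean` (same generation) proves the edge F-72 ⟹
`CossartJannsenSaito2020EmbeddedSequenceB` ⟹ F-32.  Here:

* `stub_cjs2020Thm14_of_canonicalSequence_history` — the TYPE of stub 1 from F-72 (so a skeleton keyed on F-72 needs no F-32);
* `embeddedSequenceBoundary_of_canonicalSequence_history` — **F-72 ⟹ F-60 `CossartJannsenSaito2020EmbeddedSequenceBoundary`**
  (CJS Thm. 1.4, sequence form, ARBITRARY s.n.c. start boundary off the components of `X`): an s.n.c. set on a regular Noetherian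
  scheme is presented by finitely many pairwise distinct irreducible members (`LegalRestart.exists_boundary_presentation`), which is
  F-72's input format; the process is a `𝓑`-permissible sequence (`CJSHistory.IsSigmaOMaxProcess.isBPermissibleSequenceB`).

Net for the census of stub 1: the CJS trust base {F-32, F-60, F-72} of the tree collapses to {F-72} (kernel edges F-72 ⟹ F-60 ⟹
`…SequenceB` ⟹ F-32; the middle edge is the tree's `CossartJannsenSaito2020EmbeddedSequenceBoundary.sequenceB`).  CONDITIONAL on
F-72 (a printed construction, LNM 2270 Ch. 4–17); nothing here proves resolution in characteristic `p`; rung 0.  AI-written; AI review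
weaker than expert review.
-/

noncomputable section

-- `Summit.ResolutionOfSingularities.ResolutionOfSingularities` (summit = problem) duplicates a namespace component by design (D-0017).
set_option linter.dupNamespace false

open CategoryTheory AlgebraicGeometry TopologicalSpace
open Literature.AlgebraicGeometry.Resolution
open Literature.AlgebraicGeometry.Resolution.CJSHistory

namespace Summit.ResolutionOfSingularities.ResolutionOfSingularities.Theorems.RadicialJung.CleanModels

universe u

/-- **F-72 ⟹ F-60**: the general-boundary sequence form of CJS Thm. 1.4 (`CossartJannsenSaito2020EmbeddedSequenceBoundary`)
from the construction fact `CossartJannsenSaito2020_canonicalSequence_history`: present the s.n.c. boundary `B` by its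
irreducible components (`LegalRestart.exists_boundary_presentation`), run F-72, and read its `Σ^{O,max}`-process as a sequence of
complete `𝓑`-permissible blow-ups (`IsSigmaOMaxProcess.isBPermissibleSequenceB`); the end clauses are carried verbatim.
[cite: CossartJannsenSaito2020, Thm. 1.4 (pp. 5–6), Thm. 6.9 (a) (p. 83), Cor. 6.26 (p. 89)] -/
theorem embeddedSequenceBoundary_of_canonicalSequence_history
    (h : CossartJannsenSaito2020_canonicalSequence_history.{u}) :
    CossartJannsenSaito2020EmbeddedSequenceBoundary.{u} := by
  intro X Z i _ _ _ B hreg hexc hdim hB hcomp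
  obtain ⟨Bf, k, hU, hge, hmem, hinj, -⟩ := LegalRestart.exists_boundary_presentation hreg hB
  subst hU
  obtain ⟨Z₁, π, X₁, B₁, k₁, O₁, hproc, -, hZ₁, hπ, hsurj, hUo, hX₁, hB₁, htot, htr⟩ :=
    h X Z i Bf k hreg hexc hdim hB hge hmem hinj hcomp
  obtain ⟨hseq, -⟩ := hproc.isBPermissibleSequenceB hge
  exact ⟨Z₁, π, X₁, ⋃ j, B₁ j, hseq, hZ₁, hπ, hsurj, hUo, hX₁, hB₁, htot, htr⟩

/-- **The TYPE of stub 1 (`stub_cjs2020Thm14 : CossartJannsenSaito2020Embedded.{0}`, F-32 = CJS Thm. 1.4 with `B = ∅` and the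
p. 7 consequences) from F-72**, by `CossartJannsenSaito2020Embedded.of_canonicalSequence_history`.
[cite: CossartJannsenSaito2020, Thm. 1.4 (pp. 5–6) and p. 7, Cor. 6.26 (p. 89)] -/
theorem stub_cjs2020Thm14_of_canonicalSequence_history
    (h72 : CossartJannsenSaito2020_canonicalSequence_history.{0}) :
    CossartJannsenSaito2020Embedded.{0} :=
  CossartJannsenSaito2020Embedded.of_canonicalSequence_history h72

/-- The same through the general-boundary form: F-72 ⟹ F-60 ⟹ sequence form (`𝓑 = ∅`) ⟹ F-32 (all three edges kernel-checked:
`embeddedSequenceBoundary_of_canonicalSequence_history`, the tree's `CossartJannsenSaito2020EmbeddedSequenceBoundary.sequenceB` and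
`CossartJannsenSaito2020EmbeddedSequenceB.embedded`). [cite: CossartJannsenSaito2020, Thm. 1.4 (pp. 5–6) and p. 7] -/
theorem stub_cjs2020Thm14_of_canonicalSequence_history' (h72 : CossartJannsenSaito2020_canonicalSequence_history.{0}) :
    CossartJannsenSaito2020Embedded.{0} :=
  (embeddedSequenceBoundary_of_canonicalSequence_history h72).sequenceB.embedded

/-! ## Appended (hand-1 g21, same generation): stub 2's TYPE with F-32 replaced by F-72

The hand-1 g20 leaf list of stub 2 (`stub_cossartPiltant2019 : CossartPiltant2019.{0}`) was {CP 2019 Thm. 1.5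
(`CossartPiltant2019Local`), F-32, `CossartPiltant2008_lemma94_kummerCore`, `CossartPiltant2008_prop93`, `Hironaka1964_local`}
(`cossartPiltant2019_of_stub1_of_lemma94_of_prop93_of_hironaka`).  With F-32 ⟸ F-72 the CJS entry of that list may be taken to be
F-72, the construction fact the res-hironaka files already hold. -/

/-- **The TYPE of stub 2 (`CossartPiltant2019.{0}`, CP 2019 Thm. 1.1 weak form) from {CP 2019 Thm. 1.5, F-72, [CoP1] Lemma 9.4
(Kummer core), [CoP1] Prop. 9.3, Hironaka 1964 (local, characteristic zero only)}** — `cossartPiltant2019_of_stub1_of_lemma94_of_prop93_of_hironaka`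
with its F-32 input produced from F-72 by `CossartJannsenSaito2020Embedded.of_canonicalSequence_history`.
[cite: CossartPiltant2019, Thm. 1.1, Thm. 1.5, Props. 4.4, 4.6, 4.8, 4.10] [cite: CossartPiltant2008, Lemma 9.4, Prop. 9.3]
[cite: CossartJannsenSaito2020, Thm. 1.4, Cor. 6.26] -/
theorem cossartPiltant2019_of_history_of_lemma94_of_prop93_of_hironaka
    (hloc : CossartPiltant2019Local.{0}) (h72 : CossartJannsenSaito2020_canonicalSequence_history.{0})
    (h94 : CossartPiltant2008_lemma94_kummerCore.{0}) (h93 : CossartPiltant2008_prop93.{0})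
    (hH : Hironaka1964_local.{0}) : CossartPiltant2019.{0} :=
  cossartPiltant2019_of_stub1_of_lemma94_of_prop93_of_hironaka hloc
    (CossartJannsenSaito2020Embedded.of_canonicalSequence_history h72) h94 h93 hH

/-! ## Appended (hand-1 g21): the characteristic-`p` slice of stub 2 with ALL leaves named and NO Hironaka —
## {CP 2019 Thm. 1.5, F-72, [CoP1] Lemma 9.4 (Kummer core), [CoP1] Prop. 9.3}

Kernel source for the re-key recommended in the hand-1 g19/g20 memos §4(b) (the crux lives at characteristic `p`; the consumers of
`stub_cossartPiltant2019` need only `ResolutionOverUpToDim k 3` / `LocalUniformization3 k` for fields `k` of characteristic `p`). -/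

/-- **Resolution up to dimension three over every field of characteristic `p`** from {CP 2019 Thm. 1.5 (`CossartPiltant2019Local`),
F-72 (`CossartJannsenSaito2020_canonicalSequence_history`), `CossartPiltant2008_lemma94_kummerCore`, `CossartPiltant2008_prop93`} —
`resolutionOverUpToDim_three_of_stub1_of_kummer_of_unram_charP` (hand-1 g20) with F-32 produced from F-72 and the two push-down
statements passed by name. No characteristic-zero input. [cite: CossartPiltant2019, Thm. 1.1, Thm. 1.5, Props. 4.4, 4.6, 4.8, 4.10]
[cite: CossartPiltant2008, Lemma 9.4, Prop. 9.3] [cite: CossartJannsenSaito2020, Thm. 1.4, Cor. 6.26] -/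
theorem resolutionOverUpToDim_three_of_history_of_lemma94_of_prop93_charP (p : ℕ) (hp : p.Prime)
    (hloc : CossartPiltant2019Local.{0}) (h72 : CossartJannsenSaito2020_canonicalSequence_history.{0})
    (h94 : CossartPiltant2008_lemma94_kummerCore.{0}) (h93 : CossartPiltant2008_prop93.{0})
    (k : Type) [Field k] [CharP k p] : ResolutionOverUpToDim.{0} k 3 :=
  resolutionOverUpToDim_three_of_stub1_of_kummer_of_unram_charP p hp hloc
    (CossartJannsenSaito2020Embedded.of_canonicalSequence_history h72) h94 h93 k

/-- **Local uniformization in dimension three over every field of characteristic `p`** from the same four named statements —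
`localUniformization3_of_stub1_of_kummer_of_unram_charP` (hand-1 g20) with F-32 produced from F-72.
[cite: CossartPiltant2019, Thm. 1.5, Props. 4.4, 4.6, 4.8, 4.10] [cite: CossartPiltant2008, Lemma 9.4, Prop. 9.3]
[cite: CossartJannsenSaito2020, Thm. 1.4, Cor. 6.26] -/
theorem localUniformization3_of_history_of_lemma94_of_prop93_charP (p : ℕ) (hp : p.Prime)
    (hloc : CossartPiltant2019Local.{0}) (h72 : CossartJannsenSaito2020_canonicalSequence_history.{0})
    (h94 : CossartPiltant2008_lemma94_kummerCore.{0}) (h93 : CossartPiltant2008_prop93.{0})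
    (k : Type) [Field k] [CharP k p] : LocalUniformization3 k :=
  localUniformization3_of_stub1_of_kummer_of_unram_charP p hp hloc
    (CossartJannsenSaito2020Embedded.of_canonicalSequence_history h72) h94 h93 k

/-! ## Appended (hand-1 g21): the all-characteristic TYPE of stub 2 with Hironaka's all-dimension local theorem replaced by
## Cossart–Piltant's own characteristic-zero input `CossartPiltant2019LUCompleteChar0` ((LU) for complete local domains of dim 3, char 0) -/

/-- **The TYPE of stub 2 (`CossartPiltant2019.{0}`) from {CP 2019 Thm. 1.5, F-72, [CoP1] Lemma 9.4 (Kummer core), [CoP1] Prop. 9.3,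
`CossartPiltant2019LUCompleteChar0`}** — the proof of `cossartPiltant2019_of_stub1_of_lemma94_of_prop93_of_hironaka` (hand-1 g20) with
F-32 produced from F-72 and, in residue characteristic `0`, (LU) for complete three-dimensional local domains taken from the SHARPER named
input `CossartPiltant2019LUCompleteChar0` (CP 2019, proof of Prop. 4.10, first paragraph; ⟸ Temkin 2008 in the tree,
`CossartPiltant2019LUCompleteChar0.of_temkin2008`) instead of `Hironaka1964_local` (all dimensions).
[cite: CossartPiltant2019, Thm. 1.1, Thm. 1.5, Props. 4.4, 4.6, 4.8, 4.10] [cite: CossartPiltant2008, Lemma 9.4, Prop. 9.3]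
[cite: CossartJannsenSaito2020, Thm. 1.4, Cor. 6.26] [cite: Temkin2008, Thm. 1.1] -/
theorem cossartPiltant2019_of_history_of_lemma94_of_prop93_of_luCompleteChar0
    (hloc : CossartPiltant2019Local.{0}) (h72 : CossartJannsenSaito2020_canonicalSequence_history.{0})
    (h94 : CossartPiltant2008_lemma94_kummerCore.{0}) (h93 : CossartPiltant2008_prop93.{0})
    (h0 : CossartPiltant2019LUCompleteChar0.{0}) : CossartPiltant2019.{0} := by
  have hCJSE : CossartJannsenSaito2020Embedded.{0} :=
    CossartJannsenSaito2020Embedded.of_canonicalSequence_history h72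
  intro k _ X f hsep hlft hqc hred hdim
  obtain ⟨p, hp⟩ := CharP.exists k
  have hLU3 : ∀ (A : Type) [CommRing A] [IsDomain A] [IsLocalRing A] [IsNoetherianRing A]
      [IsAdicComplete (IsLocalRing.maximalIdeal A) A],
      ringKrullDim A = 3 → CharP (IsLocalRing.ResidueField A) p → CPLocalUniformization A := by
    intro A _ _ _ _ _ hdimA hchar
    rcases CharP.char_is_prime_or_zero k p with hprime | h0'
    · exact cossartPiltant2019ReductionP_of_emb_of_kummer hloc
        Summit.ResolutionOfSingularities.ResolutionOfSingularities.Theorems.CP2008Prop44.CossartPiltant2019Principalization_holds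
        hCJSE (CossartJannsenSaito2020Embedded.cor15 hCJSE) h94 h93 hloc p hprime A hdimA hchar
    · subst h0'
      haveI : CharZero (IsLocalRing.ResidueField A) := CharP.charP_to_charZero (IsLocalRing.ResidueField A)
      exact h0 A hdimA inferInstance
  exact Summit.ResolutionOfSingularities.ResolutionOfSingularities.Theorems.CP2008Prop44.CossartPiltant2019Patching_holds
    k (cossartJannsenSaito2020_of_embedded hCJSE k)
    (localUniformization3_of_stub1_of_luComplete3 p hCJSE hLU3 k) X f hsep hlft hqc hred hdim

end Summit.ResolutionOfSingularities.ResolutionOfSingularities.Theorems.RadicialJung.CleanModels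

end
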